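import Summits.CriticalPhenomena.PercolationContinuityZ3.Theorems.SahiBoxTP2HilbertPositivity
import Summits.CriticalPhenomena.PercolationContinuityZ3.Theorems.SahiBoxTP2Real

/-!
# Laws on `ℝ^ℕ` with box-TP₂ finite-dimensional marginals: Sahi positivity for bounded monotone functionals

Support file of the Sahi cell (`prim-sahi`, typer seat, generation 12; `--supports stmt-CriticalPhenomena-4575`).
Real-valued coordinates (generation 11's `SahiBoxTP2Real.lean`, in infinite dimension).

The hypothesis is put on the FINITE-DIMENSIONAL MARGINALS: `ν ∘ (finRestrict d)⁻¹` box-TP₂ on `ℝ^d` for every `d`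
(e.g. MTP₂ densities w.r.t. any product reference measure, generation 11's `IsBoxTP2.withDensity_pi`; Gaussian
vectors with M-matrix precision, `IsBoxTP2.withDensity_pi_quadPotential`).  For a finite measure this is EQUIVALENT
to box-TP₂ on `ℝ^ℕ` itself (`isBoxTP2_iff_forall_map_finRestrict_real`, generation 13, at the end of the file): the
boxes `Icc a b` of `ℝ^ℕ` have arbitrary sequences as corners (a box with uniformly bounded corners is null for an
i.i.d. Gaussian sequence, but corners may grow), and by tightness every cylinder over a box of `ℝ^d` is exhausted in
measure by compact sets, each of which lies in such a box with the prescribed first `d` faces.  The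
coordinatewise sigmoid `sigmoidSeq : ℝ^ℕ → [0,1]^ℕ` turns such a law into a box-TP₂ law on the Hilbert cube
(`isBoxTP2_map_sigmoidSeq`: marginal by marginal, `IsBoxTP2.map_sigmoidPi`, and the marginal criterion
`isBoxTP2_iff_forall_map_finRestrict_unitInterval`); the coordinatewise logit is monotone on the open Hilbert cube,
which carries the image law, so the Hilbert-cube coupling pulls back:

* `msahiE_nonneg_of_boxTP2_marginals_realSeq` — **given `LiebSahiContinuum d n` for all `d` (⟺ `SahiConjecture n`),
  every probability measure on `ℝ^ℕ` with box-TP₂ finite-dimensional marginals satisfies `E_n(f_0,…,f_{n−1}) ≥ 0` for all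
  BOUNDED measurable nonnegative monotone `f_i`** (+ `_antitone`, `_of_sahiConjecture`); UNCONDITIONALLY `n ≤ 2`: the
  FKG inequality `integral_mul_integral_le_of_boxTP2_marginals_realSeq`.
* `IsBoxTP2.of_boxTP2_marginals_realSeq` — such a law is box-TP₂ on `ℝ^ℕ` (continuity from above along the
  cylinders over the initial-segment faces); `IsBoxTP2.map_finRestrict_real` — conversely, a finite box-TP₂ law on
  `ℝ^ℕ` has box-TP₂ finite-dimensional marginals (inner regularity by compact sets, which have order-bounded
  coordinates); `isBoxTP2_iff_forall_map_finRestrict_real` — the two notions agree (referee finding A41-1 of the cell,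
  correcting the generation-12 header which claimed the converse fails).

No sorries, no new axioms.
-/

noncomputable section

namespace Summit.CriticalPhenomena.PercolationContinuityZ3.Theorems.SahiBoxTP2

open MeasureTheory ProbabilityTheory Set Filter Topology Function Literature.Combinatorics.Sahi2008
open scoped ENNReal unitInterval

/-! ### The coordinatewise sigmoid and logit on sequences -/

section Maps

/-- Coordinatewise sigmoid `ℝ^ℕ → [0,1]^ℕ`. -/
def sigmoidSeq (x : ℕ → ℝ) : ℕ → I := fun k => unitInterval.sigmoid (x k)

/-- Coordinatewise logit `[0,1]^ℕ → ℝ^ℕ` (value irrelevant at boundary coordinates). -/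
def logitSeq (u : ℕ → I) : ℕ → ℝ := fun k => logit (u k)

/-- The open Hilbert cube: all coordinates in `(0,1)`. -/
def openHilbert : Set (ℕ → I) := {u | ∀ k, ((u k : I) : ℝ) ∈ Ioo 0 1}

/-- The coordinatewise sigmoid is measurable. [folklore] -/
theorem measurable_sigmoidSeq : Measurable sigmoidSeq :=
  measurable_pi_lambda _ fun k => unitInterval.continuous_sigmoid.measurable.comp (measurable_pi_apply k)

/-- The coordinatewise logit is measurable. [folklore] -/
theorem measurable_logitSeq : Measurable logitSeq :=
  measurable_pi_lambda _ fun k => measurable_logit.comp (measurable_pi_apply k)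

/-- `logit ∘ sigmoid = id` coordinatewise. [folklore] -/
theorem logitSeq_sigmoidSeq (x : ℕ → ℝ) : logitSeq (sigmoidSeq x) = x :=
  funext fun k => logit_sigmoid (x k)

/-- The open Hilbert cube is measurable. [folklore] -/
theorem measurableSet_openHilbert : MeasurableSet openHilbert := by
  have h : openHilbert = ⋂ k, {u : ℕ → I | ((u k : I) : ℝ) ∈ Ioo 0 1} := by
    ext u; simp only [openHilbert, mem_setOf_eq, mem_iInter]
  rw [h]
  exact MeasurableSet.iInter fun k => (measurable_subtype_coe.comp (measurable_pi_apply k)) measurableSet_Ioo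

/-- The coordinatewise sigmoid lands in the open Hilbert cube. [folklore] -/
theorem sigmoidSeq_mem_openHilbert (x : ℕ → ℝ) : sigmoidSeq x ∈ openHilbert :=
  fun k => ⟨unitInterval.sigmoid_pos (x k), unitInterval.sigmoid_lt_one (x k)⟩

/-- The coordinatewise logit is monotone on the open Hilbert cube. [folklore] -/
theorem logitSeq_monotoneOn : MonotoneOn logitSeq openHilbert :=
  fun _ hu _ hv huv k => logit_le_logit (hu k) (hv k) (huv k)

/-- The first `d` coordinates of the sigmoid sequence are the `d`-dimensional sigmoid of the first `d` coordinates.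
[folklore] -/
theorem finRestrict_comp_sigmoidSeq (d : ℕ) : finRestrict d ∘ sigmoidSeq = sigmoidPi ∘ finRestrict d := by
  funext x k; rfl

/-- The image law of the coordinatewise sigmoid is carried by the open Hilbert cube. [folklore] -/
theorem ae_map_sigmoidSeq_mem_openHilbert (ν : Measure (ℕ → ℝ)) :
    ∀ᵐ u ∂(ν.map sigmoidSeq), u ∈ openHilbert := by
  rw [ae_iff]
  change (ν.map sigmoidSeq) openHilbertᶜ = 0
  rw [Measure.map_apply measurable_sigmoidSeq measurableSet_openHilbert.compl]
  have h : sigmoidSeq ⁻¹' openHilbertᶜ = ∅ :=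
    Set.eq_empty_of_forall_notMem fun x hx => hx (sigmoidSeq_mem_openHilbert x)
  rw [h, measure_empty]

end Maps

/-! ### From box-TP₂ marginals on `ℝ^d` to a box-TP₂ law on the Hilbert cube -/

section BoxTP2

variable (ν : Measure (ℕ → ℝ))

/-- **A law on `ℝ^ℕ` with box-TP₂ finite-dimensional marginals maps, under the coordinatewise sigmoid, to a box-TP₂ law
on the Hilbert cube.** [this work] -/
theorem isBoxTP2_map_sigmoidSeq [IsFiniteMeasure ν] (hν : ∀ d, IsBoxTP2 (ν.map (finRestrict d))) :
    IsBoxTP2 (ν.map sigmoidSeq) := by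
  haveI : IsFiniteMeasure (ν.map sigmoidSeq) := Measure.isFiniteMeasure_map ν _
  refine isBoxTP2_iff_forall_map_finRestrict_unitInterval.2 fun d => ?_
  rw [Measure.map_map (measurable_finRestrict d) measurable_sigmoidSeq, finRestrict_comp_sigmoidSeq,
    ← Measure.map_map measurable_sigmoidPi (measurable_finRestrict d)]
  exact (hν d).map_sigmoidPi _

/-- Such a law is also box-TP₂ on `ℝ^ℕ` (continuity from above along the cylinders over the initial-segment faces;
the converse is `IsBoxTP2.map_finRestrict_real` below). [this work] -/
theorem IsBoxTP2.of_boxTP2_marginals_realSeq [IsFiniteMeasure ν] (hν : ∀ d, IsBoxTP2 (ν.map (finRestrict d))) :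
    IsBoxTP2 ν := by
  intro a b a' b'
  have hfin : ∀ s : Set (ℕ → ℝ), ν s ≠ ∞ := fun s => measure_ne_top ν s
  have hIcc : ∀ (d : ℕ) (a b : Fin d → ℝ), MeasurableSet (Icc a b) := fun _ _ _ => measurableSet_Icc
  refine le_of_tendsto_of_tendsto'
    (ENNReal.Tendsto.mul (tendsto_map_finRestrict_Icc ν hIcc a b) (Or.inr (hfin _))
      (tendsto_map_finRestrict_Icc ν hIcc a' b') (Or.inr (hfin _)))
    (ENNReal.Tendsto.mul (tendsto_map_finRestrict_Icc ν hIcc (a ⊓ a') (b ⊓ b')) (Or.inr (hfin _))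
      (tendsto_map_finRestrict_Icc ν hIcc (a ⊔ a') (b ⊔ b')) (Or.inr (hfin _))) fun d => ?_
  exact hν d (finRestrict d a) (finRestrict d b) (finRestrict d a') (finRestrict d b')

variable {ν} {n : ℕ}

/-- **`(∀ d, LiebSahiContinuum d n)` ⟹ every probability measure on `ℝ^ℕ` with box-TP₂ finite-dimensional marginals
satisfies `E_n(f_0,…,f_{n−1}) ≥ 0` for all bounded measurable nonnegative monotone `f_i`** (coordinatewise sigmoid to
the Hilbert cube, a.e.-monotone coupling there, coordinatewise logit back). [this work] -/
theorem msahiE_nonneg_of_boxTP2_marginals_realSeq (hL : ∀ d, LiebSahiContinuum d n) (ν : Measure (ℕ → ℝ))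
    [IsProbabilityMeasure ν] (hν : ∀ d, IsBoxTP2 (ν.map (finRestrict d))) (f : Fin n → (ℕ → ℝ) → ℝ)
    (hfm : ∀ i, Measurable (f i)) (hf0 : ∀ i x, 0 ≤ f i x) {M : ℝ} (hfM : ∀ i x, f i x ≤ M)
    (hmono : ∀ i, Monotone (f i)) : 0 ≤ msahiE ν n f := by
  haveI : IsProbabilityMeasure (ν.map sigmoidSeq) :=
    Measure.isProbabilityMeasure_map measurable_sigmoidSeq.aemeasurable
  obtain ⟨G, S, hGm, hS, hG, hGμ⟩ := exists_aemonotone_coupling_hilbert (ν.map sigmoidSeq)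
    (isBoxTP2_map_sigmoidSeq ν hν)
  have hν' : ν = lebesgueHilbert.map (logitSeq ∘ G) := by
    rw [← Measure.map_map measurable_logitSeq hGm, hGμ, Measure.map_map measurable_logitSeq measurable_sigmoidSeq]
    conv_lhs => rw [← Measure.map_id (μ := ν)]
    congr 1
    funext x
    exact (logitSeq_sigmoidSeq x).symm
  have hGS : ∀ᵐ u ∂lebesgueHilbert, u ∈ S ∩ G ⁻¹' openHilbert := by
    have h2 : ∀ᵐ u ∂lebesgueHilbert, G u ∈ openHilbert := by
      have h3 := ae_map_sigmoidSeq_mem_openHilbert ν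
      rw [← hGμ] at h3
      exact ae_of_ae_map hGm.aemeasurable h3
    filter_upwards [hS, h2] with u h1 h2 using ⟨h1, h2⟩
  have hmono' : MonotoneOn (logitSeq ∘ G) (S ∩ G ⁻¹' openHilbert) := fun u hu v hv huv =>
    logitSeq_monotoneOn hu.2 hv.2 (hG hu.1 hv.1 huv)
  rw [hν']
  exact msahiE_map_lebesgueHilbert_nonneg_of_monotoneOn hL (measurable_logitSeq.comp hGm) hGS hmono' f hfm hf0 hfM
    hmono

/-- The same from `C_n`. [this work; cite: Sahi2008, Conj. 5 (p. 212); LiebSahi2021, Conj. 1.1] -/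
theorem msahiE_nonneg_of_boxTP2_marginals_realSeq_of_sahiConjecture (hC : SahiConjecture n) (ν : Measure (ℕ → ℝ))
    [IsProbabilityMeasure ν] (hν : ∀ d, IsBoxTP2 (ν.map (finRestrict d))) (f : Fin n → (ℕ → ℝ) → ℝ)
    (hfm : ∀ i, Measurable (f i)) (hf0 : ∀ i x, 0 ≤ f i x) {M : ℝ} (hfM : ∀ i x, f i x ≤ M)
    (hmono : ∀ i, Monotone (f i)) : 0 ≤ msahiE ν n f :=
  msahiE_nonneg_of_boxTP2_marginals_realSeq ((sahiConjecture_iff_forall_liebSahiContinuum n).1 hC) ν hν f hfm hf0 hfM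
    hmono

/-- Negation `ℝ^ℕ → ℝ^ℕ` reverses the order and maps boxes to boxes; the marginals of the reflected law are the
reflected marginals, hence box-TP₂. [folklore] -/
theorem boxTP2_marginals_map_neg [IsFiniteMeasure ν] (hν : ∀ d, IsBoxTP2 (ν.map (finRestrict d))) (d : ℕ) :
    IsBoxTP2 ((ν.map fun x : ℕ → ℝ => -x).map (finRestrict d)) := by
  have hneg : Measurable fun x : ℕ → ℝ => -x := measurable_neg
  have hnegd : Measurable fun y : Fin d → ℝ => -y := measurable_neg
  rw [Measure.map_map (measurable_finRestrict d) hneg,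
    show finRestrict d ∘ (fun x : ℕ → ℝ => -x) = (fun y : Fin d → ℝ => -y) ∘ finRestrict d from funext fun x => rfl,
    ← Measure.map_map hnegd (measurable_finRestrict d)]
  -- negation on `ℝ^d` is the order-reversing isomorphism to the order dual; box-TP₂ is self-dual
  intro a b a' b'
  have hpre : ∀ p q : Fin d → ℝ, (fun y : Fin d → ℝ => -y) ⁻¹' Icc p q = Icc (-q) (-p) := fun p q => by
    ext y; simp only [mem_preimage, mem_Icc, Pi.le_def, Pi.neg_apply]
    constructor
    · rintro ⟨h1, h2⟩; exact ⟨fun i => neg_le.1 (h2 i), fun i => le_neg.2 (h1 i)⟩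
    · rintro ⟨h1, h2⟩; exact ⟨fun i => le_neg.1 (h2 i), fun i => neg_le.2 (h1 i)⟩
  simp only [Measure.map_apply hnegd measurableSet_Icc, hpre, neg_inf, neg_sup]
  have key := hν d (-b) (-a) (-b') (-a')
  rw [mul_comm (ν.map (finRestrict d) (Icc (-b ⊔ -b') (-a ⊔ -a')))]
  exact key

/-- **Decreasing families** on `ℝ^ℕ` (reflect `x ↦ −x`). [this work] -/
theorem msahiE_nonneg_of_boxTP2_marginals_realSeq_antitone (hL : ∀ d, LiebSahiContinuum d n) (ν : Measure (ℕ → ℝ))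
    [IsProbabilityMeasure ν] (hν : ∀ d, IsBoxTP2 (ν.map (finRestrict d))) (f : Fin n → (ℕ → ℝ) → ℝ)
    (hfm : ∀ i, Measurable (f i)) (hf0 : ∀ i x, 0 ≤ f i x) {M : ℝ} (hfM : ∀ i x, f i x ≤ M)
    (hanti : ∀ i, Antitone (f i)) : 0 ≤ msahiE ν n f := by
  have hneg : Measurable fun x : ℕ → ℝ => -x := measurable_neg
  haveI : IsProbabilityMeasure (ν.map fun x : ℕ → ℝ => -x) := Measure.isProbabilityMeasure_map hneg.aemeasurable
  have hmp : MeasurePreserving (fun x : ℕ → ℝ => -x) (ν.map fun x : ℕ → ℝ => -x) ν := by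
    refine ⟨hneg, ?_⟩
    rw [Measure.map_map hneg hneg]
    convert Measure.map_id (μ := ν) using 2
    funext x; exact neg_neg x
  have hme : MeasurableEmbedding fun x : ℕ → ℝ => -x := (MeasurableEquiv.neg (ℕ → ℝ)).measurableEmbedding
  rw [← msahiE_comp_measurePreserving hmp hme n f]
  exact msahiE_nonneg_of_boxTP2_marginals_realSeq hL (ν.map fun x : ℕ → ℝ => -x) (boxTP2_marginals_map_neg hν)
    (fun i => f i ∘ fun x => -x) (fun i => (hfm i).comp hneg) (fun i x => hf0 i _) (fun i x => hfM i _)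
    fun i x y hxy => hanti i (neg_le_neg hxy)

/-- **Unconditionally: the FKG inequality for laws on `ℝ^ℕ` with box-TP₂ finite-dimensional marginals** — e.g. every
real sequence whose finite-dimensional laws have MTP₂ densities — for bounded measurable nonnegative monotone `f, g`.
[this work] -/
theorem integral_mul_integral_le_of_boxTP2_marginals_realSeq (ν : Measure (ℕ → ℝ)) [IsProbabilityMeasure ν]
    (hν : ∀ d, IsBoxTP2 (ν.map (finRestrict d))) {f g : (ℕ → ℝ) → ℝ} (hfm : Measurable f) (hgm : Measurable g)
    (hf0 : ∀ x, 0 ≤ f x) (hg0 : ∀ x, 0 ≤ g x) {M : ℝ} (hfM : ∀ x, f x ≤ M) (hgM : ∀ x, g x ≤ M) (hf : Monotone f)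
    (hg : Monotone g) : (∫ x, f x ∂ν) * (∫ x, g x ∂ν) ≤ ∫ x, f x * g x ∂ν := by
  have h := msahiE_nonneg_of_boxTP2_marginals_realSeq (fun d => liebSahiContinuum_of_order_le_two d le_rfl) ν hν
    ![f, g] (fun i => by fin_cases i <;> assumption) (fun i => by fin_cases i <;> assumption) (M := M)
    (fun i => by fin_cases i <;> assumption) (fun i => by fin_cases i <;> assumption)
  rw [msahiE_two] at h
  linarith

end BoxTP2

/-! ### Conversely: a box-TP₂ law on `ℝ^ℕ` has box-TP₂ finite-dimensional marginals (generation 13)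

Referee finding A41-1 of the cell: the boxes `Icc a b` of `ℝ^ℕ` have ARBITRARY sequences as corners, so they are not
small — every compact set lies in one (`exists_subset_Icc_of_isCompact_seq`), and a finite Borel measure on the Polish
space `ℝ^ℕ` is inner regular by compact sets.  A compact subset of the cylinder over `[a,b] ⊆ ℝ^d` lies in the box with
first `d` faces `[a,b]` and the compact set's own coordinate bounds as tail faces (`finExtendSeq`); two such boxes
with a COMMON tail have meet and join boxes with the same tail, inside the cylinders over `[a ⊓ a', b ⊓ b']` and
`[a ⊔ a', b ⊔ b']`.  Hence `IsBoxTP2 ν → IsBoxTP2 (ν.map (finRestrict d))` and, with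
`IsBoxTP2.of_boxTP2_marginals_realSeq`, the equivalence `isBoxTP2_iff_forall_map_finRestrict_real`. -/

section Converse

variable {X : Type*}

/-- Extension of a `d`-tuple to a sequence by the tail of a given sequence (`finExtend d a c` is the case of a
constant tail). -/
def finExtendSeq (d : ℕ) (a : Fin d → X) (c : ℕ → X) : ℕ → X := fun i => if h : i < d then a ⟨i, h⟩ else c i

/-- On the first `d` indices `finExtendSeq` returns the tuple. [folklore] -/
theorem finExtendSeq_of_lt {d : ℕ} (a : Fin d → X) (c : ℕ → X) {i : ℕ} (hi : i < d) :
    finExtendSeq d a c i = a ⟨i, hi⟩ := by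
  simp only [finExtendSeq, dif_pos hi]

/-- Beyond the first `d` indices `finExtendSeq` returns the tail sequence. [folklore] -/
theorem finExtendSeq_of_le {d : ℕ} (a : Fin d → X) (c : ℕ → X) {i : ℕ} (hi : d ≤ i) :
    finExtendSeq d a c i = c i := by
  simp only [finExtendSeq, dif_neg (not_lt.2 hi)]

/-- `finRestrict ∘ finExtendSeq = id` on tuples. [folklore] -/
@[simp] theorem finRestrict_finExtendSeq {d : ℕ} (a : Fin d → X) (c : ℕ → X) :
    finRestrict d (finExtendSeq d a c) = a := by
  funext i
  simp only [finRestrict_apply, finExtendSeq_of_lt a c i.2]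

/-- `finExtendSeq` with the same tail commutes with binary meets. [folklore] -/
theorem finExtendSeq_inf [Lattice X] {d : ℕ} (a a' : Fin d → X) (c : ℕ → X) :
    finExtendSeq d (a ⊓ a') c = finExtendSeq d a c ⊓ finExtendSeq d a' c := by
  funext i
  by_cases hi : i < d
  · simp only [Pi.inf_apply, finExtendSeq_of_lt _ _ hi]
  · simp only [Pi.inf_apply, finExtendSeq_of_le _ _ (not_lt.1 hi), inf_idem]

/-- `finExtendSeq` with the same tail commutes with binary joins. [folklore] -/
theorem finExtendSeq_sup [Lattice X] {d : ℕ} (a a' : Fin d → X) (c : ℕ → X) :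
    finExtendSeq d (a ⊔ a') c = finExtendSeq d a c ⊔ finExtendSeq d a' c := by
  funext i
  by_cases hi : i < d
  · simp only [Pi.sup_apply, finExtendSeq_of_lt _ _ hi]
  · simp only [Pi.sup_apply, finExtendSeq_of_le _ _ (not_lt.1 hi), sup_idem]

/-- A box of `ℕ → X` whose first `d` faces are `[a,b]` lies in the cylinder over `[a,b]`. [folklore] -/
theorem Icc_finExtendSeq_subset [Preorder X] {d : ℕ} (a b : Fin d → X) (lo hi : ℕ → X) :
    Icc (finExtendSeq d a lo) (finExtendSeq d b hi) ⊆ finRestrict d ⁻¹' Icc a b := by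
  rintro u ⟨h1, h2⟩
  refine ⟨fun i => ?_, fun i => ?_⟩
  · have := h1 i; rwa [finExtendSeq_of_lt _ _ i.2] at this
  · have := h2 i; rwa [finExtendSeq_of_lt _ _ i.2] at this

/-- A subset of the cylinder over `[a,b]` with all coordinates between `lo` and `hi` lies in the box with first
`d` faces `[a,b]` and tail faces `[lo,hi]`. [folklore] -/
theorem subset_Icc_finExtendSeq [Preorder X] {d : ℕ} {a b : Fin d → X} {lo hi : ℕ → X} {K : Set (ℕ → X)}
    (hK : K ⊆ finRestrict d ⁻¹' Icc a b) (hK' : K ⊆ Icc lo hi) :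
    K ⊆ Icc (finExtendSeq d a lo) (finExtendSeq d b hi) := by
  intro u hu
  obtain ⟨h1, h2⟩ := hK hu
  obtain ⟨h3, h4⟩ := hK' hu
  refine ⟨fun i => ?_, fun i => ?_⟩
  · by_cases hi : i < d
    · rw [finExtendSeq_of_lt _ _ hi]; exact h1 ⟨i, hi⟩
    · rw [finExtendSeq_of_le _ _ (not_lt.1 hi)]; exact h3 i
  · by_cases hi : i < d
    · rw [finExtendSeq_of_lt _ _ hi]; exact h2 ⟨i, hi⟩
    · rw [finExtendSeq_of_le _ _ (not_lt.1 hi)]; exact h4 i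

/-- **A compact subset of `ℝ^ℕ` lies in a box `Icc lo hi`** (every coordinate is bounded on it). [folklore] -/
theorem exists_subset_Icc_of_isCompact_seq {K : Set (ℕ → ℝ)} (hK : IsCompact K) :
    ∃ lo hi : ℕ → ℝ, K ⊆ Icc lo hi := by
  have hb : ∀ k : ℕ, ∃ m : ℝ, ∀ x ∈ K, m ≤ x k := fun k => by
    obtain ⟨m, hm⟩ := hK.bddBelow_image (continuous_apply k).continuousOn
    exact ⟨m, fun x hx => hm (mem_image_of_mem (fun x : ℕ → ℝ => x k) hx)⟩
  have ha : ∀ k : ℕ, ∃ m : ℝ, ∀ x ∈ K, x k ≤ m := fun k => by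
    obtain ⟨m, hm⟩ := hK.bddAbove_image (continuous_apply k).continuousOn
    exact ⟨m, fun x hx => hm (mem_image_of_mem (fun x : ℕ → ℝ => x k) hx)⟩
  choose lo hlo using hb
  choose hi hhi using ha
  exact ⟨lo, hi, fun x hx => ⟨fun k => hlo k x hx, fun k => hhi k x hx⟩⟩

/-- **A finite box-TP₂ law on `ℝ^ℕ` has box-TP₂ finite-dimensional marginals** (inner regularity by compact sets;
the cylinder masses are suprema of masses of boxes with prescribed first `d` faces and a common tail, to which
box-TP₂ on `ℝ^ℕ` applies).  Converse of `IsBoxTP2.of_boxTP2_marginals_realSeq`. [this work] -/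
theorem IsBoxTP2.map_finRestrict_real {ν : Measure (ℕ → ℝ)} [IsFiniteMeasure ν] (hν : IsBoxTP2 ν) (d : ℕ) :
    IsBoxTP2 (ν.map (finRestrict d)) := by
  intro a b a' b'
  have hC : ∀ p q : Fin d → ℝ, MeasurableSet (finRestrict d ⁻¹' Icc p q) := fun p q =>
    measurableSet_Icc.preimage (measurable_finRestrict d)
  simp only [Measure.map_apply (measurable_finRestrict d) measurableSet_Icc]
  rw [(hC a b).measure_eq_iSup_isCompact_of_ne_top (measure_ne_top ν _),
    (hC a' b').measure_eq_iSup_isCompact_of_ne_top (measure_ne_top ν _), ENNReal.iSup_mul]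
  refine iSup_le fun K₁ => ?_
  rw [ENNReal.iSup_mul]
  refine iSup_le fun hK₁ => ?_
  rw [ENNReal.iSup_mul]
  refine iSup_le fun hK₁c => ?_
  rw [ENNReal.mul_iSup]
  refine iSup_le fun K₂ => ?_
  rw [ENNReal.mul_iSup]
  refine iSup_le fun hK₂ => ?_
  rw [ENNReal.mul_iSup]
  refine iSup_le fun hK₂c => ?_
  obtain ⟨lo, hi, hKK⟩ := exists_subset_Icc_of_isCompact_seq (hK₁c.union hK₂c)
  have h₁ : K₁ ⊆ Icc (finExtendSeq d a lo) (finExtendSeq d b hi) :=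
    subset_Icc_finExtendSeq hK₁ (subset_union_left.trans hKK)
  have h₂ : K₂ ⊆ Icc (finExtendSeq d a' lo) (finExtendSeq d b' hi) :=
    subset_Icc_finExtendSeq hK₂ (subset_union_right.trans hKK)
  calc ν K₁ * ν K₂
      ≤ ν (Icc (finExtendSeq d a lo) (finExtendSeq d b hi)) *
          ν (Icc (finExtendSeq d a' lo) (finExtendSeq d b' hi)) :=
        mul_le_mul' (measure_mono h₁) (measure_mono h₂)
    _ ≤ ν (Icc (finExtendSeq d a lo ⊓ finExtendSeq d a' lo) (finExtendSeq d b hi ⊓ finExtendSeq d b' hi)) *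
          ν (Icc (finExtendSeq d a lo ⊔ finExtendSeq d a' lo) (finExtendSeq d b hi ⊔ finExtendSeq d b' hi)) :=
        hν _ _ _ _
    _ ≤ ν (finRestrict d ⁻¹' Icc (a ⊓ a') (b ⊓ b')) * ν (finRestrict d ⁻¹' Icc (a ⊔ a') (b ⊔ b')) := by
        rw [← finExtendSeq_inf, ← finExtendSeq_inf, ← finExtendSeq_sup, ← finExtendSeq_sup]
        exact mul_le_mul' (measure_mono (Icc_finExtendSeq_subset _ _ _ _))
          (measure_mono (Icc_finExtendSeq_subset _ _ _ _))

/-- **On `ℝ^ℕ`, for a finite measure: box-TP₂ ⟺ every finite-dimensional marginal is box-TP₂ on `ℝ^d`** — the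
real-line mirror of the Hilbert-cube criterion `isBoxTP2_iff_forall_map_finRestrict_unitInterval`; in particular the
hypothesis `∀ d, IsBoxTP2 (ν.map (finRestrict d))` of this file is just `IsBoxTP2 ν`. [this work] -/
theorem isBoxTP2_iff_forall_map_finRestrict_real {ν : Measure (ℕ → ℝ)} [IsFiniteMeasure ν] :
    IsBoxTP2 ν ↔ ∀ d, IsBoxTP2 (ν.map (finRestrict d)) :=
  ⟨fun hν d => hν.map_finRestrict_real d, IsBoxTP2.of_boxTP2_marginals_realSeq ν⟩

variable {n : ℕ}

/-- `msahiE_nonneg_of_boxTP2_marginals_realSeq` with the intrinsic hypothesis: **given `LiebSahiContinuum d n` for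
all `d`, every box-TP₂ probability measure on `ℝ^ℕ` satisfies `E_n(f_0,…,f_{n−1}) ≥ 0` for all bounded measurable
nonnegative monotone `f_i`.** [this work] -/
theorem msahiE_nonneg_of_isBoxTP2_realSeq (hL : ∀ d, LiebSahiContinuum d n) (ν : Measure (ℕ → ℝ))
    [IsProbabilityMeasure ν] (hν : IsBoxTP2 ν) (f : Fin n → (ℕ → ℝ) → ℝ) (hfm : ∀ i, Measurable (f i))
    (hf0 : ∀ i x, 0 ≤ f i x) {M : ℝ} (hfM : ∀ i x, f i x ≤ M) (hmono : ∀ i, Monotone (f i)) :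
    0 ≤ msahiE ν n f :=
  msahiE_nonneg_of_boxTP2_marginals_realSeq hL ν (fun d => hν.map_finRestrict_real d) f hfm hf0 hfM hmono

/-- The same for decreasing families. [this work] -/
theorem msahiE_nonneg_of_isBoxTP2_realSeq_antitone (hL : ∀ d, LiebSahiContinuum d n) (ν : Measure (ℕ → ℝ))
    [IsProbabilityMeasure ν] (hν : IsBoxTP2 ν) (f : Fin n → (ℕ → ℝ) → ℝ) (hfm : ∀ i, Measurable (f i))
    (hf0 : ∀ i x, 0 ≤ f i x) {M : ℝ} (hfM : ∀ i x, f i x ≤ M) (hanti : ∀ i, Antitone (f i)) :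
    0 ≤ msahiE ν n f :=
  msahiE_nonneg_of_boxTP2_marginals_realSeq_antitone hL ν (fun d => hν.map_finRestrict_real d) f hfm hf0 hfM hanti

/-- The same from `C_n`. [this work; cite: Sahi2008, Conj. 5 (p. 212); LiebSahi2021, Conj. 1.1] -/
theorem msahiE_nonneg_of_isBoxTP2_realSeq_of_sahiConjecture (hC : SahiConjecture n) (ν : Measure (ℕ → ℝ))
    [IsProbabilityMeasure ν] (hν : IsBoxTP2 ν) (f : Fin n → (ℕ → ℝ) → ℝ) (hfm : ∀ i, Measurable (f i))
    (hf0 : ∀ i x, 0 ≤ f i x) {M : ℝ} (hfM : ∀ i x, f i x ≤ M) (hmono : ∀ i, Monotone (f i)) :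
    0 ≤ msahiE ν n f :=
  msahiE_nonneg_of_isBoxTP2_realSeq ((sahiConjecture_iff_forall_liebSahiContinuum n).1 hC) ν hν f hfm hf0 hfM hmono

/-- **Unconditionally: the FKG inequality for every box-TP₂ probability measure on `ℝ^ℕ`**, bounded measurable
nonnegative monotone `f, g`. [this work] -/
theorem integral_mul_integral_le_of_isBoxTP2_realSeq (ν : Measure (ℕ → ℝ)) [IsProbabilityMeasure ν]
    (hν : IsBoxTP2 ν) {f g : (ℕ → ℝ) → ℝ} (hfm : Measurable f) (hgm : Measurable g) (hf0 : ∀ x, 0 ≤ f x)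
    (hg0 : ∀ x, 0 ≤ g x) {M : ℝ} (hfM : ∀ x, f x ≤ M) (hgM : ∀ x, g x ≤ M) (hf : Monotone f) (hg : Monotone g) :
    (∫ x, f x ∂ν) * (∫ x, g x ∂ν) ≤ ∫ x, f x * g x ∂ν :=
  integral_mul_integral_le_of_boxTP2_marginals_realSeq ν (fun d => hν.map_finRestrict_real d) hfm hgm hf0 hg0 hfM hgM
    hf hg

end Converse

end Summit.CriticalPhenomena.PercolationContinuityZ3.Theorems.SahiBoxTP2
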